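import Literature.AlgebraicGeometry.Motives.MixedHodgeExtensionHomFunctor
import Literature.AlgebraicGeometry.Motives.MixedHodgeExtensionTensorHomAdjunction
import Literature.AlgebraicGeometry.Motives.MixedHodgeExtensionUnitInternalHomEvaluation
import Literature.AlgebraicGeometry.Motives.MixedHodgeExtensionTensorTate
import Literature.AlgebraicGeometry.Motives.MixedHodgeStructureTensorAssoc
import HarnessLib

/-!
# The tensor–Hom adjunction on `Ext¹` through unit and counit: `adj x = coev^* Hom(C, x)`, `adj⁻¹ y = ev_* (y ⊗ C)`

Deligne–Milne, *Tannakian categories* (LNM 900), §1 Def. 1.6 and (1.6.1): the internal Hom of a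
tensor category is defined by the adjunction `Hom(T ⊗ X, Y) ≅ Hom(T, Hom(X, Y))`, functorial in `T`,
with counit the evaluation `ev : Hom(X, Y) ⊗ X → Y` ("`ev` corresponds to `id_{Hom(X,Y)}`"); dually the
unit is the coevaluation `coev : T → Hom(X, T ⊗ X)` corresponding to `id_{T ⊗ X}`. Jannsen, *Mixed
Motives* (LNM 1400), §9 Remark 9.3 a) transports this to `Ext¹` of mixed Hodge structures: the tree's
`Ext.tensorHomAdj A C B : Ext(A ⊗ C, B) ≃ Ext(A, Hom(C, B))` (`MixedHodgeExtensionTensorHomAdjunction`)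
is the composite `α ∘ (curry)_* ∘ α⁻¹` of Jannsen's `α` (`Ext.unitInternalHomEquivW`, 9.3 a) verbatim:
`α(F) = (unit⁻¹)^* ev_* (F ⊗ A)`, `MixedHodgeExtensionUnitInternalHomEvaluation`).

With the internal Hom of extensions `Hom(C, E)` (`MixedHodgeExtensionHomFunctor`) this file gives the
adjunction on `Ext¹` its textbook form (all carriers finite-dimensional):

* §1 the unit **`tensorCoev A C : A → Hom(C, A ⊗ C)`**, `a ↦ (c ↦ a ⊗ c)` (= `curryHom (id_{A ⊗ C})`), the
  morphism `tensorCoevAssoc X A C : X ⊗ A → Hom(C, X ⊗ (A ⊗ C))` (= `curryHom` of the associator),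
  their naturality, the two identities `ev_{A,Hom(C,B)} ∘ (curry ⊗ 1_A) = Hom(C, ev_{A⊗C,B}) ∘ tensorCoevAssoc`
  and `tensorCoevAssoc ∘ unit⁻¹_A = Hom(C, unit⁻¹_{A⊗C}) ∘ coev`, and the **triangle identities**
  `Hom(C, ev) ∘ coev_{Hom(C,B)} = id`, `ev ∘ (coev ⊗ 1_C) = id`;
* §2 the morphisms of extensions `F ⊗ A → Hom(C, F ⊗ (A ⊗ C))` and **`G → Hom(C, G ⊗ C)`** (over `coev`);
* §3 **`Ext.tensorHomAdj A C B x = coev^* Hom(C, x)`** (`tensorHomAdj_eq_pullbackMapW_tensorCoev`) and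
  **`(Ext.tensorHomAdj A C B)⁻¹ y = ev_* (y ⊗ C)`** (`tensorHomAdj_symm_eq_pushoutMapW_homEval`) — a
  purely formal consequence of Mac Lane's `β_* E ≡ α^* E'` along the morphisms of §2 — with the
  extension-level forms `adj [E] = [coev^* Hom(C, E)]`, `adj⁻¹ [G] = [ev_* (G ⊗ C)]`, the congruence
  criterion, `Ext.tensorDualAdj` likewise, and the coherence
  **`α_{C,B}(y) = (unit⁻¹_C)^* ((adj_{ℚ(0),C,B})⁻¹ y)`** of Jannsen's `α` with the adjunction at `A = ℚ(0)`.

All statements proved; no named facts.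

## References

* [DeligneMilne1982Tannakian] P. Deligne, J. S. Milne, Tannakian categories, LNM 900 (1982), §1
  Def. 1.6, (1.6.1)–(1.6.4).
* [Jannsen1990MixedMotives] U. Jannsen, Mixed Motives and Algebraic K-Theory, LNM 1400 (1990), §9
  Remark 9.3 a).
* [MacLane1963Homology] S. Mac Lane, Homology (1963), Ch. III §1 Lemmas 1.2, 1.4, Prop. 1.8.
* [DeligneHodgeII1971] P. Deligne, Théorie de Hodge II, 1.1.12.
-/

noncomputable section

open scoped TensorProduct

namespace Literature.AlgebraicGeometry.Motives

namespace MixedHodgeStructure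

open HodgeStructure (tate)

/-! ### §1 Coevaluation, the partial coevaluation `X ⊗ A → Hom(C, X ⊗ (A ⊗ C))`, triangle identities -/

section Coev

variable {VA : Type*} [AddCommGroup VA] [Module ℚ VA] [FiniteDimensional ℚ VA]
variable {VB : Type*} [AddCommGroup VB] [Module ℚ VB] [FiniteDimensional ℚ VB]
variable {VC : Type*} [AddCommGroup VC] [Module ℚ VC] [FiniteDimensional ℚ VC]
variable {VX : Type*} [AddCommGroup VX] [Module ℚ VX] [FiniteDimensional ℚ VX]
variable {VY : Type*} [AddCommGroup VY] [Module ℚ VY] [FiniteDimensional ℚ VY]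
variable (A : MixedHodgeStructure VA) (B : MixedHodgeStructure VB) (C : MixedHodgeStructure VC)
  (X : MixedHodgeStructure VX) {Y : MixedHodgeStructure VY}

/-- **The coevaluation (unit of the tensor–Hom adjunction) `coev : A → Hom(C, A ⊗ C)`, `a ↦ (c ↦ a ⊗ c)`**:
the morphism corresponding to `id_{A ⊗ C}` under `Hom(A ⊗ C, A ⊗ C) ≅ Hom(A, Hom(C, A ⊗ C))` (the tree's
`curryHom`). [cite: DeligneMilne1982Tannakian, §1 Def. 1.6] -/
def tensorCoev : Hom A (hom C (tensor A C)) :=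
  curryHom C (tensor A C) (Hom.id (tensor A C))

/-- `coev a c = a ⊗ c` (by `rfl`). [cite: DeligneMilne1982Tannakian, §1 Def. 1.6] -/
@[simp]
theorem tensorCoev_toLinearMap_apply (a : VA) (c : VC) : (tensorCoev A C).toLinearMap a c = a ⊗ₜ[ℚ] c := rfl

/-- **The partial coevaluation `X ⊗ A → Hom(C, X ⊗ (A ⊗ C))`, `x ⊗ a ↦ (c ↦ x ⊗ (a ⊗ c))`**: the morphism
corresponding to the associativity isomorphism `(X ⊗ A) ⊗ C ≅ X ⊗ (A ⊗ C)` under the adjunction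
(`curryHom` of `tensorAssoc`; equivalently `(1_X ⊗ coev)` followed by `X ⊗ Hom(C, ·) → Hom(C, X ⊗ ·)`).
[cite: DeligneMilne1982Tannakian, §1 Def. 1.6] [cite: DeligneHodgeII1971, 1.1.12] -/
def tensorCoevAssoc : Hom (tensor X A) (hom C (tensor X (tensor A C))) :=
  curryHom C (tensor X (tensor A C)) (tensorAssoc X A C)

/-- `tensorCoevAssoc (x ⊗ a) c = x ⊗ (a ⊗ c)` (by `rfl`). [cite: DeligneMilne1982Tannakian, §1 Def. 1.6] -/
@[simp]
theorem tensorCoevAssoc_toLinearMap_apply_tmul (x : VX) (a : VA) (c : VC) :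
    (tensorCoevAssoc A C X).toLinearMap (x ⊗ₜ[ℚ] a) c = x ⊗ₜ[ℚ] (a ⊗ₜ[ℚ] c) := rfl

variable {A C X}

/-- **Naturality of the coevaluation**: `coev_Y ∘ g = Hom(C, g ⊗ 1_C) ∘ coev_X` for `g : X → Y`.
[cite: DeligneMilne1982Tannakian, §1 (1.6.1)] -/
theorem tensorCoev_comp (C : MixedHodgeStructure VC) (g : Hom X Y) :
    (tensorCoev Y C).comp g = (Hom.homMap (Hom.id C) (g.tensorMap (Hom.id C))).comp (tensorCoev X C) :=
  Hom.ext (LinearMap.ext fun x => LinearMap.ext fun c => by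
    simp only [Hom.comp_toLinearMap, LinearMap.comp_apply, tensorCoev_toLinearMap_apply,
      Hom.homMap_toLinearMap_apply, Hom.id_toLinearMap, LinearMap.id_apply, Hom.tensorMap_apply_tmul])

/-- **Naturality of the partial coevaluation in `X`**: `n_Y ∘ (g ⊗ 1_A) = Hom(C, g ⊗ 1_{A⊗C}) ∘ n_X`.
[cite: DeligneMilne1982Tannakian, §1 (1.6.1)] -/
theorem tensorCoevAssoc_comp_tensorMap_id (A : MixedHodgeStructure VA) (C : MixedHodgeStructure VC) (g : Hom X Y) :
    (tensorCoevAssoc A C Y).comp (g.tensorMap (Hom.id A)) =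
      (Hom.homMap (Hom.id C) (g.tensorMap (Hom.id (tensor A C)))).comp (tensorCoevAssoc A C X) :=
  Hom.ext (TensorProduct.ext' fun x a => LinearMap.ext fun c => by
    simp only [Hom.comp_toLinearMap, LinearMap.comp_apply, Hom.tensorMap_apply_tmul, Hom.id_toLinearMap,
      LinearMap.id_apply, tensorCoevAssoc_toLinearMap_apply_tmul, Hom.homMap_toLinearMap_apply])

variable (A C)

/-- **`ev_{A, Hom(C,B)} ∘ (curry ⊗ 1_A) = Hom(C, ev_{A⊗C, B}) ∘ n_{Hom(A⊗C, B)}`** as morphisms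
`Hom(A ⊗ C, B) ⊗ A → Hom(C, B)`: both send `ψ ⊗ a` to `c ↦ ψ(a ⊗ c)`. [cite: DeligneMilne1982Tannakian, §1 Def. 1.6 and (1.6.3)] -/
theorem homEval_comp_homTensorCurry_tensorMap_id :
    (homEval A (hom C B)).comp ((homTensorCurry A C B).tensorMap (Hom.id A)) =
      (Hom.homMap (Hom.id C) (homEval (tensor A C) B)).comp (tensorCoevAssoc A C (hom (tensor A C) B)) :=
  Hom.ext (TensorProduct.ext' fun ψ a => LinearMap.ext fun c => by
    simp only [Hom.comp_toLinearMap, LinearMap.comp_apply, Hom.tensorMap_apply_tmul, Hom.id_toLinearMap,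
      LinearMap.id_apply, homEval_apply_tmul, homTensorCurry_toLinearMap_apply, Hom.homMap_toLinearMap_apply,
      tensorCoevAssoc_toLinearMap_apply_tmul])

/-- **`n_{ℚ(0)} ∘ unit⁻¹_A = Hom(C, unit⁻¹_{A⊗C}) ∘ coev_A`** as morphisms `A → Hom(C, ℚ(0) ⊗ (A ⊗ C))`:
both send `a` to `c ↦ 1 ⊗ (a ⊗ c)`. [cite: DeligneMilne1982Tannakian, §1 Def. 1.6] [cite: DeligneHodgeII1971, 2.1.13] -/
theorem tensorCoevAssoc_comp_unitTensorInv₀ :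
    (tensorCoevAssoc A C (tate (-0)).toMixedHodgeStructure).comp (unitTensorInv₀ A) =
      (Hom.homMap (Hom.id C) (unitTensorInv₀ (tensor A C))).comp (tensorCoev A C) :=
  Hom.ext (LinearMap.ext fun a => LinearMap.ext fun c => by
    simp only [Hom.comp_toLinearMap, LinearMap.comp_apply, unitTensorInv₀_toLinearMap_apply,
      tensorCoevAssoc_toLinearMap_apply_tmul, Hom.homMap_toLinearMap_apply, Hom.id_toLinearMap,
      LinearMap.id_apply, tensorCoev_toLinearMap_apply])

/-- **Triangle identity `Hom(C, ev_{C,B}) ∘ coev_{Hom(C,B)} = id_{Hom(C,B)}`** (`f ↦ (c ↦ f ⊗ c) ↦ (c ↦ f c)`).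
[cite: DeligneMilne1982Tannakian, §1 Def. 1.6] -/
theorem homMap_homEval_comp_tensorCoev :
    (Hom.homMap (Hom.id C) (homEval C B)).comp (tensorCoev (hom C B) C) = Hom.id (hom C B) :=
  Hom.ext (LinearMap.ext fun f => LinearMap.ext fun c => by
    simp only [Hom.comp_toLinearMap, LinearMap.comp_apply, Hom.homMap_toLinearMap_apply, Hom.id_toLinearMap,
      LinearMap.id_apply, tensorCoev_toLinearMap_apply, homEval_apply_tmul])

/-- **Triangle identity `ev_{C, A⊗C} ∘ (coev_A ⊗ 1_C) = id_{A ⊗ C}`** (`a ⊗ c ↦ (c' ↦ a ⊗ c') ⊗ c ↦ a ⊗ c`).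
[cite: DeligneMilne1982Tannakian, §1 Def. 1.6] -/
theorem homEval_comp_tensorCoev_tensorMap_id :
    (homEval C (tensor A C)).comp ((tensorCoev A C).tensorMap (Hom.id C)) = Hom.id (tensor A C) :=
  Hom.ext (TensorProduct.ext' fun a c => by
    simp only [Hom.comp_toLinearMap, LinearMap.comp_apply, Hom.tensorMap_apply_tmul, Hom.id_toLinearMap,
      LinearMap.id_apply, homEval_apply_tmul, tensorCoev_toLinearMap_apply])

/-- `coev` corresponds to `id` under the adjunction: `uncurry (coev) = id_{A ⊗ C}`. [cite: DeligneMilne1982Tannakian, §1 Def. 1.6] -/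
theorem uncurryHom_tensorCoev : uncurryHom C (tensor A C) (tensorCoev A C) = Hom.id (tensor A C) :=
  uncurryHom_curryHom C (tensor A C) (Hom.id (tensor A C))

end Coev

/-! ### §2 The morphisms of extensions `F ⊗ A → Hom(C, F ⊗ (A ⊗ C))` and `G → Hom(C, G ⊗ C)` -/

section Morphisms

variable {VA : Type*} [AddCommGroup VA] [Module ℚ VA] [FiniteDimensional ℚ VA]
variable {VC : Type*} [AddCommGroup VC] [Module ℚ VC] [FiniteDimensional ℚ VC]
variable {VK : Type*} [AddCommGroup VK] [Module ℚ VK] [FiniteDimensional ℚ VK]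
variable {VH : Type*} [AddCommGroup VH] [Module ℚ VH] [FiniteDimensional ℚ VH]
variable {VF : Type*} [AddCommGroup VF] [Module ℚ VF] [FiniteDimensional ℚ VF]
variable {K : MixedHodgeStructure VK} {H : MixedHodgeStructure VH}

namespace Extension

/-- **The morphism of extensions `F ⊗ A → Hom(C, F ⊗ (A ⊗ C))`** over `n_H : H ⊗ A → Hom(C, H ⊗ (A ⊗ C))`
and `n_K` (all three components the partial coevaluation; the squares commute by its naturality).
[cite: DeligneMilne1982Tannakian, §1 (1.6.1)] [cite: MacLane1963Homology, Ch. III §1] -/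
def rTensorToHomLeftRTensor (F : Extension K H VF) (A : MixedHodgeStructure VA) (C : MixedHodgeStructure VC) :
    Morphism (F.rTensor A) ((F.rTensor (tensor A C)).homLeft C) where
  left := tensorCoevAssoc A C H
  mid := tensorCoevAssoc A C F.mhs
  right := tensorCoevAssoc A C K
  mid_inc := by
    change (tensorCoevAssoc A C F.mhs).toLinearMap ∘ₗ (F.inc.tensorMap (Hom.id A)).toLinearMap =
      (Hom.homMap (Hom.id C) (F.inc.tensorMap (Hom.id (tensor A C)))).toLinearMap ∘ₗ
        (tensorCoevAssoc A C H).toLinearMap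
    rw [← Hom.comp_toLinearMap, ← Hom.comp_toLinearMap, tensorCoevAssoc_comp_tensorMap_id]
  proj_mid := by
    change (Hom.homMap (Hom.id C) (F.proj.tensorMap (Hom.id (tensor A C)))).toLinearMap ∘ₗ
        (tensorCoevAssoc A C F.mhs).toLinearMap =
      (tensorCoevAssoc A C K).toLinearMap ∘ₗ (F.proj.tensorMap (Hom.id A)).toLinearMap
    rw [← Hom.comp_toLinearMap, ← Hom.comp_toLinearMap, tensorCoevAssoc_comp_tensorMap_id]

/-- Components of `F ⊗ A → Hom(C, F ⊗ (A ⊗ C))` (by `rfl`). [cite: DeligneMilne1982Tannakian, §1 (1.6.1)] -/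
@[simp]
theorem rTensorToHomLeftRTensor_left (F : Extension K H VF) (A : MixedHodgeStructure VA)
    (C : MixedHodgeStructure VC) : (F.rTensorToHomLeftRTensor A C).left = tensorCoevAssoc A C H := rfl

/-- Components of `F ⊗ A → Hom(C, F ⊗ (A ⊗ C))` (by `rfl`). [cite: DeligneMilne1982Tannakian, §1 (1.6.1)] -/
@[simp]
theorem rTensorToHomLeftRTensor_right (F : Extension K H VF) (A : MixedHodgeStructure VA)
    (C : MixedHodgeStructure VC) : (F.rTensorToHomLeftRTensor A C).right = tensorCoevAssoc A C K := rfl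

/-- **The morphism of extensions `G → Hom(C, G ⊗ C)` over the coevaluations `coev_H`, `coev_K`**
(`G` an extension of `K` by `H`). [cite: DeligneMilne1982Tannakian, §1 (1.6.1)] [cite: MacLane1963Homology, Ch. III §1] -/
def toHomLeftRTensor (G : Extension K H VF) (C : MixedHodgeStructure VC) :
    Morphism G ((G.rTensor C).homLeft C) where
  left := tensorCoev H C
  mid := tensorCoev G.mhs C
  right := tensorCoev K C
  mid_inc := by
    change (tensorCoev G.mhs C).toLinearMap ∘ₗ G.inc.toLinearMap =
      (Hom.homMap (Hom.id C) (G.inc.tensorMap (Hom.id C))).toLinearMap ∘ₗ (tensorCoev H C).toLinearMap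
    rw [← Hom.comp_toLinearMap, ← Hom.comp_toLinearMap, tensorCoev_comp]
  proj_mid := by
    change (Hom.homMap (Hom.id C) (G.proj.tensorMap (Hom.id C))).toLinearMap ∘ₗ (tensorCoev G.mhs C).toLinearMap =
      (tensorCoev K C).toLinearMap ∘ₗ G.proj.toLinearMap
    rw [← Hom.comp_toLinearMap, ← Hom.comp_toLinearMap, tensorCoev_comp]

/-- Components of `G → Hom(C, G ⊗ C)` (by `rfl`). [cite: DeligneMilne1982Tannakian, §1 (1.6.1)] -/
@[simp]
theorem toHomLeftRTensor_left (G : Extension K H VF) (C : MixedHodgeStructure VC) :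
    (G.toHomLeftRTensor C).left = tensorCoev H C := rfl

/-- Components of `G → Hom(C, G ⊗ C)` (by `rfl`). [cite: DeligneMilne1982Tannakian, §1 (1.6.1)] -/
@[simp]
theorem toHomLeftRTensor_right (G : Extension K H VF) (C : MixedHodgeStructure VC) :
    (G.toHomLeftRTensor C).right = tensorCoev K C := rfl

/-- **`(n_H)_* (F ⊗ A) ≡ (n_K)^* Hom(C, F ⊗ (A ⊗ C))`** (Mac Lane III Prop. 1.8 along `F ⊗ A → Hom(C, F ⊗ (A ⊗ C))`).
[cite: MacLane1963Homology, Ch. III Prop. 1.8] -/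
theorem nonempty_congruence_rTensor_pushout_homLeft_rTensor_pullback (F : Extension K H VF)
    (A : MixedHodgeStructure VA) (C : MixedHodgeStructure VC) :
    Nonempty (Congruence ((F.rTensor A).pushout (tensorCoevAssoc A C H))
      (((F.rTensor (tensor A C)).homLeft C).pullback (tensorCoevAssoc A C K))) :=
  nonempty_congruence_pushout_pullback_of_morphism (F.rTensorToHomLeftRTensor A C)

/-- **`(coev_H)_* G ≡ (coev_K)^* Hom(C, G ⊗ C)`** (Mac Lane III Prop. 1.8 along `G → Hom(C, G ⊗ C)`).
[cite: MacLane1963Homology, Ch. III Prop. 1.8] -/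
theorem nonempty_congruence_pushout_tensorCoev_homLeft_rTensor_pullback (G : Extension K H VF)
    (C : MixedHodgeStructure VC) :
    Nonempty (Congruence (G.pushout (tensorCoev H C)) (((G.rTensor C).homLeft C).pullback (tensorCoev K C))) :=
  nonempty_congruence_pushout_pullback_of_morphism (G.toHomLeftRTensor C)

end Extension

namespace Ext

/-- **`(n_H)_* (x ⊗ A) = (n_K)^* Hom(C, x ⊗ (A ⊗ C))`** on `Ext(K, H)`. [cite: MacLane1963Homology, Ch. III Prop. 1.8] -/
theorem pushoutMapW_tensorCoevAssoc_rTensorMap (A : MixedHodgeStructure VA) (C : MixedHodgeStructure VC)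
    (x : Ext K H) :
    pushoutMapW (tensorCoevAssoc A C H) (rTensorMap A x) =
      pullbackMapW (tensorCoevAssoc A C K) (homLeftMap C (rTensorMap (tensor A C) x)) := by
  obtain ⟨F, rfl⟩ := exists_mkOfW_eq x
  rw [rTensorMap_mkOfW, rTensorMap_mkOfW, homLeftMap_mkOfW]
  exact pushoutMapW_mkOfW_eq_pullbackMapW_mkOfW (F.rTensorToHomLeftRTensor A C)

/-- **`(coev_H)_* y = (coev_K)^* Hom(C, y ⊗ C)`** on `Ext(K, H)`. [cite: MacLane1963Homology, Ch. III Prop. 1.8] -/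
theorem pushoutMapW_tensorCoev (C : MixedHodgeStructure VC) (y : Ext K H) :
    pushoutMapW (tensorCoev H C) y = pullbackMapW (tensorCoev K C) (homLeftMap C (rTensorMap C y)) := by
  obtain ⟨G, rfl⟩ := exists_mkOfW_eq y
  rw [rTensorMap_mkOfW, homLeftMap_mkOfW]
  exact pushoutMapW_mkOfW_eq_pullbackMapW_mkOfW (G.toHomLeftRTensor C)

end Ext

end Morphisms

/-! ### §3 The adjunction on `Ext¹` through unit and counit -/

section Adjunction

variable {VA : Type*} [AddCommGroup VA] [Module ℚ VA] [FiniteDimensional ℚ VA]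
variable {VB : Type*} [AddCommGroup VB] [Module ℚ VB] [FiniteDimensional ℚ VB]
variable {VC : Type*} [AddCommGroup VC] [Module ℚ VC] [FiniteDimensional ℚ VC]
variable (A : MixedHodgeStructure VA) (C : MixedHodgeStructure VC) (B : MixedHodgeStructure VB)

namespace Ext

/-- **`adj x = coev^* Hom(C, x)`**: the tensor–Hom adjunction `Ext(A ⊗ C, B) ≅ Ext(A, Hom(C, B))` sends the
class of `E` to the pull-back along the unit `coev : A → Hom(C, A ⊗ C)` of `Hom(C, E)` — formally from
`adj = α ∘ curry_* ∘ α⁻¹`, `α(F) = (unit⁻¹)^* ev_* (F ⊗ A)`, Mac Lane's `β_* ≡ α^*` along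
`F ⊗ A → Hom(C, F ⊗ (A ⊗ C))`, and the identities of §1. [cite: DeligneMilne1982Tannakian, §1 Def. 1.6 and (1.6.1)]
[cite: Jannsen1990MixedMotives, §9 Remark 9.3 a)] -/
theorem tensorHomAdj_eq_pullbackMapW_tensorCoev (x : Ext (tensor A C) B) :
    tensorHomAdj A C B x = pullbackMapW (tensorCoev A C) (homLeftMap C x) := by
  obtain ⟨F, rfl⟩ := (unitInternalHomEquivW (tensor A C) B).surjective x
  rw [tensorHomAdj_apply, Equiv.symm_apply_apply,
    unitInternalHomEquivW_eq_pullbackMapW_pushoutMapW (x := pushoutMapW (homTensorCurry A C B) F),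
    rTensorMap_pushoutMapW, ← pushoutMapW_comp, homEval_comp_homTensorCurry_tensorMap_id, pushoutMapW_comp,
    pushoutMapW_tensorCoevAssoc_rTensorMap, pushoutMapW_pullbackMapW, ← pullbackMapW_comp,
    tensorCoevAssoc_comp_unitTensorInv₀, pullbackMapW_comp, ← homLeftMap_pushoutMapW, ← homLeftMap_pullbackMapW,
    ← unitInternalHomEquivW_eq_pullbackMapW_pushoutMapW]

/-- **`adj [E] = [coev^* Hom(C, E)]`** for an extension `E` of `A ⊗ C` by `B` on any carrier.
[cite: DeligneMilne1982Tannakian, §1 Def. 1.6 and (1.6.1)] -/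
theorem tensorHomAdj_mkOfW_eq {VE : Type*} [AddCommGroup VE] [Module ℚ VE] [FiniteDimensional ℚ VE]
    (E : Extension (tensor A C) B VE) :
    tensorHomAdj A C B (mkOfW E) = mkOfW ((E.homLeft C).pullback (tensorCoev A C)) := by
  rw [tensorHomAdj_eq_pullbackMapW_tensorCoev, homLeftMap_mkOfW, pullbackMapW_mkOfW]

/-- **`adj⁻¹ y = ev_* (y ⊗ C)`**: the inverse adjunction sends the class of `G` (an extension of `A` by
`Hom(C, B)`) to the push-out along the counit `ev : Hom(C, B) ⊗ C → B` of `G ⊗ C` (from the unit form,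
Mac Lane's `β_* ≡ α^*` along `G → Hom(C, G ⊗ C)`, and the triangle identity `Hom(C, ev) ∘ coev = id`).
[cite: DeligneMilne1982Tannakian, §1 Def. 1.6 and (1.6.1)] [cite: Jannsen1990MixedMotives, §9 Remark 9.3 a)] -/
theorem tensorHomAdj_symm_eq_pushoutMapW_homEval (y : Ext A (hom C B)) :
    (tensorHomAdj A C B).symm y = pushoutMapW (homEval C B) (rTensorMap C y) := by
  apply (tensorHomAdj A C B).injective
  rw [Equiv.apply_symm_apply, tensorHomAdj_eq_pullbackMapW_tensorCoev, homLeftMap_pushoutMapW,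
    ← pushoutMapW_pullbackMapW, ← pushoutMapW_tensorCoev, ← pushoutMapW_comp, homMap_homEval_comp_tensorCoev,
    pushoutMapW_id]

/-- **`adj⁻¹ [G] = [ev_* (G ⊗ C)]`** for an extension `G` of `A` by `Hom(C, B)` on any carrier.
[cite: DeligneMilne1982Tannakian, §1 Def. 1.6 and (1.6.1)] -/
theorem tensorHomAdj_symm_mkOfW_eq {VG : Type*} [AddCommGroup VG] [Module ℚ VG] [FiniteDimensional ℚ VG]
    (G : Extension A (hom C B) VG) :
    (tensorHomAdj A C B).symm (mkOfW G) = mkOfW ((G.rTensor C).pushout (homEval C B)) := by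
  rw [tensorHomAdj_symm_eq_pushoutMapW_homEval, rTensorMap_mkOfW, pushoutMapW_mkOfW]

/-- **`adj [E] = [G]` iff `coev^* Hom(C, E) ≡ G`**, for extensions on arbitrary carriers.
[cite: DeligneMilne1982Tannakian, §1 (1.6.1)] [cite: MacLane1963Homology, Ch. III §1] -/
theorem tensorHomAdj_mkOfW_eq_mkOfW_iff_congruence {VE : Type*} [AddCommGroup VE] [Module ℚ VE]
    [FiniteDimensional ℚ VE] {VG : Type*} [AddCommGroup VG] [Module ℚ VG] [FiniteDimensional ℚ VG]
    (E : Extension (tensor A C) B VE) (G : Extension A (hom C B) VG) :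
    tensorHomAdj A C B (mkOfW E) = mkOfW G ↔
      Nonempty (Extension.Congruence ((E.homLeft C).pullback (tensorCoev A C)) G) := by
  rw [tensorHomAdj_mkOfW_eq, mkOfW_eq_mkOfW_iff]

/-- Conversely `adj⁻¹ [G] = [E]` iff `ev_* (G ⊗ C) ≡ E`. [cite: DeligneMilne1982Tannakian, §1 (1.6.1)]
[cite: MacLane1963Homology, Ch. III §1] -/
theorem tensorHomAdj_symm_mkOfW_eq_mkOfW_iff_congruence {VE : Type*} [AddCommGroup VE] [Module ℚ VE]
    [FiniteDimensional ℚ VE] {VG : Type*} [AddCommGroup VG] [Module ℚ VG] [FiniteDimensional ℚ VG]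
    (G : Extension A (hom C B) VG) (E : Extension (tensor A C) B VE) :
    (tensorHomAdj A C B).symm (mkOfW G) = mkOfW E ↔
      Nonempty (Extension.Congruence ((G.rTensor C).pushout (homEval C B)) E) := by
  rw [tensorHomAdj_symm_mkOfW_eq, mkOfW_eq_mkOfW_iff]

/-- **`x = ev_* ((coev^* Hom(C, x)) ⊗ C)`**: unit then counit is the identity on `Ext(A ⊗ C, B)`.
[cite: DeligneMilne1982Tannakian, §1 Def. 1.6] -/
theorem pushoutMapW_homEval_rTensorMap_pullbackMapW_tensorCoev_homLeftMap (x : Ext (tensor A C) B) :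
    pushoutMapW (homEval C B) (rTensorMap C (pullbackMapW (tensorCoev A C) (homLeftMap C x))) = x := by
  rw [← tensorHomAdj_eq_pullbackMapW_tensorCoev, ← tensorHomAdj_symm_eq_pushoutMapW_homEval,
    Equiv.symm_apply_apply]

/-- **`y = coev^* Hom(C, ev_* (y ⊗ C))`**: counit then unit is the identity on `Ext(A, Hom(C, B))`.
[cite: DeligneMilne1982Tannakian, §1 Def. 1.6] -/
theorem pullbackMapW_tensorCoev_homLeftMap_pushoutMapW_homEval_rTensorMap (y : Ext A (hom C B)) :
    pullbackMapW (tensorCoev A C) (homLeftMap C (pushoutMapW (homEval C B) (rTensorMap C y))) = y := by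
  rw [← tensorHomAdj_eq_pullbackMapW_tensorCoev, ← tensorHomAdj_symm_eq_pushoutMapW_homEval,
    Equiv.apply_symm_apply]

/-- **`Ext.tensorDualAdj` through the unit**: `Ext(A ⊗ C, B) ≅ Ext(A, C^∨ ⊗ B)` is
`x ↦ (Hom(C, B) ≅ C^∨ ⊗ B)_* coev^* Hom(C, x)`. [cite: DeligneMilne1982Tannakian, §1 (1.6.4)] -/
theorem tensorDualAdj_eq_pushoutMapW_pullbackMapW_tensorCoev (x : Ext (tensor A C) B) :
    tensorDualAdj A C B x = pushoutMapW (homToTensor C B) (pullbackMapW (tensorCoev A C) (homLeftMap C x)) := by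
  rw [tensorDualAdj_apply, tensorHomAdj_eq_pullbackMapW_tensorCoev]

/-- **Coherence of Jannsen's `α` with the adjunction at `A = ℚ(0)`**:
`α_{C,B}(y) = (unit⁻¹_C)^* (adj_{ℚ(0),C,B})⁻¹(y) = (unit⁻¹_C)^* ev_* (y ⊗ C)` for `y ∈ Ext(ℚ(0), Hom(C, B))`.
[cite: Jannsen1990MixedMotives, §9 Remark 9.3 a)] [cite: DeligneMilne1982Tannakian, §1 (1.6.4)] -/
theorem unitInternalHomEquivW_eq_pullbackMapW_tensorHomAdj_symm
    (y : Ext (tate (-0)).toMixedHodgeStructure (hom C B)) :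
    unitInternalHomEquivW C B y =
      pullbackMapW (unitTensorInv₀ C) ((tensorHomAdj (tate (-0)).toMixedHodgeStructure C B).symm y) := by
  rw [tensorHomAdj_symm_eq_pushoutMapW_homEval, unitInternalHomEquivW_eq_pullbackMapW_pushoutMapW]

/-- Equivalently `(adj_{ℚ(0),C,B})⁻¹(y) = (unit_C)^* α_{C,B}(y)` with `unit_C : ℚ(0) ⊗ C → C`.
[cite: Jannsen1990MixedMotives, §9 Remark 9.3 a)] [cite: DeligneHodgeII1971, 2.1.13] -/
theorem tensorHomAdj_unit_symm_eq_pullbackMapW_unitInternalHomEquivW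
    (y : Ext (tate (-0)).toMixedHodgeStructure (hom C B)) :
    (tensorHomAdj (tate (-0)).toMixedHodgeStructure C B).symm y =
      pullbackMapW (unitTensorHom C) (unitInternalHomEquivW C B y) := by
  rw [unitInternalHomEquivW_eq_pullbackMapW_tensorHomAdj_symm, ← pullbackMapW_comp]
  change _ = pullbackMapW ((unitTensorInv C).comp (unitTensorHom C)) _
  rw [unitTensorInv_comp_unitTensorHom, pullbackMapW_id]

end Ext

end Adjunction

end MixedHodgeStructure

end Literature.AlgebraicGeometry.Motives

end
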